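import Summits.BirchSwinnertonDyer.Rank1Residual.ManinAdditive.SigmaEtaKummer
import HarnessLib

/-!
# Parity lemmas and the Kronecker character for the `Σ(N)[2]` level law (an g35, T-an-35′/T-an-37, Part A)

TYPER NOTE (typer g19, TURNKEY T-an-37 v2, part 1/3 of file A).  SOURCE = HOME/an/g35/SigmaThetaParity-an-g35-v2.lean sha16
3284279ff549c8a2 (950 l.; an: farm rc 0 · 0 err · 0 warn · 4.8 s; axioms of the node ⊆ {propext, Classical.choice, Quot.sound}), lines 1–332
VERBATIM except: this note; one-line docstrings added on an's undocumented helper lemmas (gate `lint.docstring`); an's 3-line lemma `χ₈_neg`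
INLINED as a local `have` at its single call site (it restates the tree's `TunnellThetaAutomorphyProofs.χ₈_neg` — `dedup.landed`).  SPLIT for the
400-line cap on theorem-bearing files: part 1 (this file) = Jacobi/Kronecker lemmas, `kroneckerChar`, the 2-adic divisor bookkeeping, the cusp
conditions; part 2 `SigmaThetaParityNode.lean` = the fibre sums, the finite parity engine, the product `s'` and THE NODE `exists_shimuraTwoChar_eq_jacobiSym`
(S-an-g34-2 spelled out); part 3 `SigmaThetaFamily.lean` = the theta family (E-an-157 spelled out); `SigmaThetaRadical.lean` = file C (E-an-156
spelled out); `SigmaThetaHolds.lean` = file B (the five by-name closures).  Theorem-only apart from `kroneckerChar`; nothing conjectured;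
no instance / notation / decide-on-data.  PARTITION 0 · beyond-print theorem: yes, modest (an) · BSD / C2 / Manin `c = 1` NOT proved by this.

This file (imports only `SigmaEtaKummer`) proves, with the statement SPELLED OUT, the content of the node
`SigmaTheta.KroneckerShimuraCharAtFour` (S-an-g34-2) as `exists_shimuraTwoChar_eq_jacobiSym`; the by-name one-liners
`kroneckerShimuraCharAtFour_holds`, `shimuraTwoCharOfJacobiProductAtFour_holds`, `etaSquareKummerIsSigmaAtFour_holds` (E-an-155
unconditional) live in the sibling `SigmaThetaHolds.lean` (Part B, imports `SigmaTheta`).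

For `4 ∣ N`, an exponent vector `2r` on the divisors of `N` with Newman's congruences and EVEN cusp orders of the
`η`-quotient `∏ η(tτ)^{2 r_t}`: the Kronecker symbol `d ↦ (s' | |d|)`, `s' = ∏ t^{|r_t|}`, restricted to odd `d` coprime
to `N`, is the restriction of an even quadratic Dirichlet character `χ mod N` which kills every cusp stabiliser
`1 + a·c·(N / gcd(N, c²))` of `Γ₀(N)`.

Proof (elementary): write `N = 2ⁿ·M` (`M` odd, `n ≥ 2`), `s' = b²·q` (`q` squarefree).  The even-cusp-order conditions
at the cusps `c = 2^i·M` (`0 ≤ i ≤ n`) are linear congruences modulo `24·2^{i+min(i,n−i)}` in the fibre sums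
`X_j = Σ_{v₂(t)=j} r_t·oddpart(t)`; for `n ∈ {2,3,4}` they force `v₂(s')` even (PARITY LEMMA 1: `2 ∣ q ⟹ 32 ∣ N`) and for
`n = 2` they force `Σ_t r_t·oddpart(t) ≡ 0 (mod 4)`, i.e. `q ≡ 1 (mod 4)` (PARITY LEMMA 2).  Hence `4q ∣ N`, so
`(q | ·)` is a Dirichlet character mod `N` (periodicity of the Jacobi symbol mod `4q`); it is even (reciprocity); and
since `N ∣ (c·w_c)²`, `w_c = N/gcd(N,c²)`, every prime of `N` divides `c·w_c`, `4 ∣ c·w_c` once `8 ∣ N` and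
`8 ∣ c·w_c` once `32 ∣ N`, so reciprocity evaluates `(q | 1 + a·c·w_c) = 1`.
-/

namespace Summit.BirchSwinnertonDyer.Rank1Residual.ManinAdditive.SigmaEta

open Literature.NumberTheory.ModularForms
open Literature.NumberTheory.EllipticCurves.ModularForms
open scoped NumberTheorySymbols
open ZMod


/-! ### Jacobi-symbol lemmas -/

/-- `J(q | ·)` on odd arguments is periodic modulo any multiple of `4q`. -/
theorem jacobiSym_mod_eq_of_dvd (q : ℕ) {N m : ℕ} (h : 4 * q ∣ N) (hm : Odd m) (hN : Even N) :
    J(q | m % N) = J(q | m) := by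
  rw [jacobiSym.mod_right' q (hm.mod_even hN), Nat.mod_mod_of_dvd m h, ← jacobiSym.mod_right' q hm]

/-- `χ₄` is odd. -/
theorem χ₄_neg (x : ZMod 4) : χ₄ (-x) = -χ₄ x := by
  rw [neg_eq_neg_one_mul, map_mul]
  have : χ₄ (-1 : ZMod 4) = -1 := by decide
  rw [this, neg_one_mul]

/-- `χ₄(n)² = 1` for odd `n`. -/
theorem χ₄_sq_eq_one_of_odd {n : ℕ} (hn : Odd n) : χ₄ n * χ₄ n = 1 := by
  rcases Nat.odd_mod_four_iff.mp (Nat.odd_iff.mp hn) with h | h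
  · rw [χ₄_nat_one_mod_four h]; norm_num
  · rw [χ₄_nat_three_mod_four h]; norm_num

/-- For natural numbers `m₁ + m₂ ≡ 0 (mod k)` the casts satisfy `(m₂ : ZMod k) = -m₁`. -/
theorem natCast_eq_neg_of_dvd_add {k m₁ m₂ : ℕ} (h : k ∣ m₁ + m₂) : (m₂ : ZMod k) = -(m₁ : ZMod k) := by
  have : ((m₁ + m₂ : ℕ) : ZMod k) = 0 := (ZMod.natCast_eq_zero_iff _ _).mpr h
  rw [Nat.cast_add] at this
  linear_combination this

/-- **Evenness of the Kronecker symbol `(q | ·)` for `q > 0`**: `J(q | m₁) = J(q | m₂)` for odd `m₁ ≡ -m₂ (mod 4q)`. -/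
theorem jacobiSym_eq_of_dvd_add {q m₁ m₂ : ℕ} (hq : q ≠ 0) (h₁ : Odd m₁) (h₂ : Odd m₂)
    (h : 4 * q ∣ m₁ + m₂) : J(q | m₁) = J(q | m₂) := by
  obtain ⟨e, q', hq'2, hqe⟩ := Nat.exists_eq_pow_mul_and_not_dvd hq 2 (by norm_num)
  have hq'odd : Odd q' := Nat.odd_iff.mpr (Nat.two_dvd_ne_zero.mp hq'2)
  rw [hqe, Nat.cast_mul, jacobiSym.mul_left, jacobiSym.mul_left, Nat.cast_pow, jacobiSym.pow_left,
    jacobiSym.pow_left, Nat.cast_two, jacobiSym.at_two h₁, jacobiSym.at_two h₂,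
    jacobiSym.quadratic_reciprocity' hq'odd h₁, jacobiSym.quadratic_reciprocity' hq'odd h₂]
  have hq'dvd : (q' : ℤ) ∣ (m₁ : ℤ) + m₂ := by
    have : (q' : ℕ) ∣ m₁ + m₂ := (Dvd.intro_left _ hqe.symm).trans ((Dvd.intro_left _ rfl).trans h)
    exact_mod_cast this
  have h4dvd : 4 ∣ m₁ + m₂ := (Dvd.intro _ rfl).trans h
  congr 1
  · -- the `χ₈` part
    rcases Nat.eq_zero_or_pos e with rfl | he
    · simp
    · have h8 : 8 ∣ m₁ + m₂ := by
        have : 8 ∣ 4 * q := by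
          rw [hqe, show e = (e - 1) + 1 by omega, pow_succ]
          exact ⟨2 ^ (e - 1) * q', by ring⟩
        exact this.trans h
      have hχ₈ : ∀ x : ZMod 8, χ₈ (-x) = χ₈ x := fun x => by
        rw [neg_eq_neg_one_mul, map_mul, show χ₈ (-1 : ZMod 8) = 1 by decide, one_mul]
      rw [natCast_eq_neg_of_dvd_add h8, hχ₈]
  · -- the odd part `q'`
    obtain ⟨k, hk⟩ := hq'dvd
    have hm₂ : (m₂ : ℤ) = -m₁ + q' * k := by linarith
    rw [qrSign, qrSign, natCast_eq_neg_of_dvd_add h4dvd, χ₄_neg, jacobiSym.neg _ hq'odd,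
      jacobiSym.mod_left' (a₁ := (m₂ : ℤ)) (a₂ := -m₁) (by rw [hm₂, Int.add_mul_emod_self_left]),
      jacobiSym.neg _ hq'odd]
    have := χ₄_sq_eq_one_of_odd hq'odd
    linear_combination (-(J(χ₄ ↑m₁ | q') * J(↑m₁ | q'))) * this

/-- **Shimura evaluation**: `J(q | 1 + y) = 1` when `y` is even, `q ∣ y`, (`4 ∣ y` or `q ≡ 1 (mod 4)`), and
`8 ∣ y` as soon as `q` is even. -/
theorem jacobiSym_one_add_eq_one {q y : ℕ} (hq : q ≠ 0) (hy2 : 2 ∣ y) (hqy : q ∣ y)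
    (h4 : 4 ∣ y ∨ q % 4 = 1) (h8 : 2 ∣ q → 8 ∣ y) : J(q | 1 + y) = 1 := by
  obtain ⟨e, q', hq'2, hqe⟩ := Nat.exists_eq_pow_mul_and_not_dvd hq 2 (by norm_num)
  have hq'odd : Odd q' := Nat.odd_iff.mpr (Nat.two_dvd_ne_zero.mp hq'2)
  have hyodd : Odd (1 + y) := by
    obtain ⟨k, hk⟩ := hy2; exact ⟨k, by omega⟩
  rw [hqe, Nat.cast_mul, jacobiSym.mul_left, Nat.cast_pow, jacobiSym.pow_left, Nat.cast_two,
    jacobiSym.at_two hyodd, jacobiSym.quadratic_reciprocity' hq'odd hyodd]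
  have hq'y : q' ∣ y := (Dvd.intro_left _ hqe.symm).trans hqy
  -- `J(1 + y | q') = 1`
  have hJ : J(((1 + y : ℕ) : ℤ) | q') = 1 := by
    obtain ⟨k, hk⟩ := hq'y
    rw [jacobiSym.mod_left' (a₁ := ((1 + y : ℕ) : ℤ)) (a₂ := 1)
      (by rw [hk]; push_cast; rw [Int.add_mul_emod_self_left]), jacobiSym.one_left]
  -- `qrSign (1 + y) q' = 1`
  have hS : qrSign (1 + y) q' = 1 := by
    rcases h4 with h4 | h4
    · rw [qrSign, χ₄_nat_one_mod_four (by omega), jacobiSym.one_left]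
    · -- then `q` is odd, `e = 0`, `q' = q ≡ 1 (mod 4)`
      have he : e = 0 := by
        by_contra he
        have : 2 ∣ q := by
          rw [hqe, show e = (e - 1) + 1 by omega, pow_succ]; exact ⟨2 ^ (e - 1) * q', by ring⟩
        have := h8 this
        omega
      subst he
      have hqq : q' = q := by simpa using hqe.symm
      rw [qrSign.symm hyodd hq'odd, qrSign, hqq, χ₄_nat_one_mod_four h4, jacobiSym.one_left]
  -- `χ₈ (1 + y) ^ e = 1`
  have hE : χ₈ ((1 + y : ℕ) : ZMod 8) ^ e = 1 := by
    rcases Nat.eq_zero_or_pos e with rfl | he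
    · simp
    · have h2q : 2 ∣ q := by
        rw [hqe, show e = (e - 1) + 1 by omega, pow_succ]; exact ⟨2 ^ (e - 1) * q', by ring⟩
      have h8y := h8 h2q
      rw [χ₈_nat_mod_eight, show (1 + y) % 8 = 1 by omega]
      simp
  rw [hE, hS, hJ]; simp

/-! ### The Kronecker character `(q | ·)` as a Dirichlet character mod `N` (`4q ∣ N`) -/

/-- `m % N` is coprime to `N` iff `m` is. -/
theorem coprime_mod_iff {m N : ℕ} : Nat.Coprime (m % N) N ↔ Nat.Coprime m N := by
  unfold Nat.Coprime
  rw [← Nat.gcd_rec, Nat.gcd_comm]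

/-- A number coprime to an even number is odd. -/
theorem odd_of_coprime_even {m N : ℕ} (hN : Even N) (h : Nat.Coprime m N) : Odd m := by
  rw [← Nat.not_even_iff_odd]
  rintro ⟨k, hk⟩
  obtain ⟨l, hl⟩ := hN
  have : 2 ∣ Nat.gcd m N := Nat.dvd_gcd ⟨k, by omega⟩ ⟨l, by omega⟩
  rw [h] at this
  omega

/-- `4q ∣ N ⟹ N` even. -/
theorem even_of_four_mul_dvd {q N : ℕ} (hq : 4 * q ∣ N) : Even N := by
  obtain ⟨k, hk⟩ := hq; exact ⟨2 * q * k, by rw [hk]; ring⟩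

/-- The Kronecker character `x ↦ (q | x)` modulo `N`, for `4q ∣ N`, `N ≠ 0`. -/
noncomputable def kroneckerChar (N q : ℕ) (hq : 4 * q ∣ N) (hN : N ≠ 0) : DirichletCharacter ℤ N where
  toFun x := if Nat.Coprime x.val N then J(q | x.val) else 0
  map_one' := by
    have hN4 : 4 ≤ N := by
      obtain ⟨k, hk⟩ := hq
      rcases Nat.eq_zero_or_pos q with rfl | hq0
      · simp at hk; exact absurd hk hN
      · rcases Nat.eq_zero_or_pos k with rfl | hk0
        · simp at hk; exact absurd hk hN
        · nlinarith
    haveI : Fact (1 < N) := ⟨by omega⟩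
    show (if Nat.Coprime (1 : ZMod N).val N then J(q | (1 : ZMod N).val) else 0) = 1
    rw [ZMod.val_one, if_pos (Nat.coprime_one_left _), jacobiSym.one_right]
  map_mul' x y := by
    have hNe : Even N := even_of_four_mul_dvd hq
    have hN1 : N ≠ 1 := by rintro rfl; obtain ⟨k, hk⟩ := hNe; omega
    show (if Nat.Coprime (x * y).val N then J(q | (x * y).val) else 0) =
      (if Nat.Coprime x.val N then J(q | x.val) else 0) * (if Nat.Coprime y.val N then J(q | y.val) else 0)
    rw [ZMod.val_mul]
    by_cases hx : Nat.Coprime x.val N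
    · by_cases hy : Nat.Coprime y.val N
      · have hxy : Nat.Coprime (x.val * y.val % N) N := coprime_mod_iff.mpr (Nat.Coprime.mul_left hx hy)
        rw [if_pos hxy, if_pos hx, if_pos hy]
        have hx0 : x.val ≠ 0 := by
          intro h0; rw [h0] at hx; exact hN1 (Nat.coprime_zero_left _ |>.mp hx)
        have hy0 : y.val ≠ 0 := by
          intro h0; rw [h0] at hy; exact hN1 (Nat.coprime_zero_left _ |>.mp hy)
        rw [jacobiSym_mod_eq_of_dvd q hq ((odd_of_coprime_even hNe hx).mul (odd_of_coprime_even hNe hy)) hNe,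
          jacobiSym.mul_right' _ hx0 hy0]
      · have hxy : ¬ Nat.Coprime (x.val * y.val % N) N := by
          rw [coprime_mod_iff]; exact fun h => hy (Nat.Coprime.coprime_dvd_left (Dvd.intro_left _ rfl) h)
        rw [if_neg hxy, if_neg hy, mul_zero]
    · have hxy : ¬ Nat.Coprime (x.val * y.val % N) N := by
        rw [coprime_mod_iff]; exact fun h => hx (Nat.Coprime.coprime_dvd_left (Dvd.intro _ rfl) h)
      rw [if_neg hxy, if_neg hx, zero_mul]
  map_nonunit' x hx := by
    haveI : NeZero N := ⟨hN⟩
    have : ¬ Nat.Coprime x.val N := by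
      intro h
      apply hx
      have := (ZMod.isUnit_iff_coprime x.val N).mpr h
      rwa [ZMod.natCast_zmod_val] at this
    show (if Nat.Coprime x.val N then J(q | x.val) else 0) = 0
    rw [if_neg this]

/-- `kroneckerChar N q` at a natural number `m` coprime to `N` is the Jacobi symbol `J(q | m)`. -/
theorem kroneckerChar_apply_natCast {N q : ℕ} (hq : 4 * q ∣ N) (hN : N ≠ 0) {m : ℕ} (hm : Nat.Coprime m N) :
    kroneckerChar N q hq hN (m : ZMod N) = J(q | m) := by
  have hNe : Even N := even_of_four_mul_dvd hq
  show (if Nat.Coprime (m : ZMod N).val N then J(q | (m : ZMod N).val) else 0) = _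
  rw [ZMod.val_natCast, if_pos (coprime_mod_iff.mpr hm), jacobiSym_mod_eq_of_dvd q hq (odd_of_coprime_even hNe hm) hNe]

/-- `kroneckerChar N q` is even: it takes the value `1` at `-1`. -/
theorem kroneckerChar_neg_one {N q : ℕ} (hq : 4 * q ∣ N) (hN : N ≠ 0) :
    kroneckerChar N q hq hN (-1) = 1 := by
  have hq0 : q ≠ 0 := by rintro rfl; simp at hq; exact hN hq
  have hN1 : 1 ≤ N := Nat.one_le_iff_ne_zero.mpr hN
  have hcast : ((N - 1 : ℕ) : ZMod N) = -1 := by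
    rw [Nat.cast_sub hN1, ZMod.natCast_self, Nat.cast_one, zero_sub]
  have hcop : Nat.Coprime (N - 1) N := by
    have := (Nat.coprime_self_add_right (m := N - 1) (n := 1)).mpr (Nat.coprime_one_right _)
    rwa [Nat.sub_add_cancel hN1] at this
  rw [← hcast, kroneckerChar_apply_natCast hq hN hcop]
  have hNe : Even N := even_of_four_mul_dvd hq
  rw [← jacobiSym_eq_of_dvd_add (m₁ := 1) hq0 odd_one (odd_of_coprime_even hNe hcop)
    (by rw [Nat.add_sub_cancel' hN1]; exact hq), jacobiSym.one_right]

/-- Values on integers: `χ(d) = (q | |d|)` for odd `d` coprime to `N`. -/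
theorem kroneckerChar_apply_int {N q : ℕ} (hq : 4 * q ∣ N) (hN : N ≠ 0) {d : ℤ} (hd : IsCoprime d N) :
    kroneckerChar N q hq hN (d : ZMod N) = J(q | d.natAbs) := by
  have hcop : Nat.Coprime d.natAbs N := by
    have := Int.isCoprime_iff_gcd_eq_one.mp hd
    rw [Int.gcd_eq_natAbs, Int.natAbs_natCast] at this
    exact this
  rcases Int.natAbs_eq d with h | h
  · conv_lhs => rw [h]
    rw [Int.cast_natCast, kroneckerChar_apply_natCast hq hN hcop]
  · conv_lhs => rw [h]
    rw [Int.cast_neg, Int.cast_natCast, neg_eq_neg_one_mul, map_mul, kroneckerChar_neg_one hq hN, one_mul,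
      kroneckerChar_apply_natCast hq hN hcop]


/-! ### Divisors of `N = 2ⁿ·M`, `M` odd -/

/-- `gcd(2^a, 2^b) = 2^{min(a,b)}`. -/
theorem two_pow_gcd_two_pow (a b : ℕ) : Nat.gcd (2 ^ a) (2 ^ b) = 2 ^ min a b := by
  rcases le_total a b with h | h
  · rw [min_eq_left h, Nat.gcd_eq_left (pow_dvd_pow 2 h)]
  · rw [min_eq_right h, Nat.gcd_eq_right (pow_dvd_pow 2 h)]

/-- A divisor `t` of `2ⁿ·M` (`M` odd) is `2^j · u` with `j = v₂(t) ≤ n` and `u = ordCompl[2] t` odd, `u ∣ M`. -/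
theorem divisor_two_adic {n M t : ℕ} (hM : Odd M) (ht : t ∣ 2 ^ n * M) :
    t = 2 ^ (t.factorization 2) * ordCompl[2] t ∧ Odd (ordCompl[2] t) ∧ ordCompl[2] t ∣ M ∧
      t.factorization 2 ≤ n := by
  have hN0 : 2 ^ n * M ≠ 0 := by have := hM.pos; positivity
  have ht0 : t ≠ 0 := by rintro rfl; exact hN0 (zero_dvd_iff.mp ht)
  have hdec : t = 2 ^ (t.factorization 2) * ordCompl[2] t := (Nat.ordProj_mul_ordCompl_eq_self t 2).symm
  have hodd : Odd (ordCompl[2] t) := Nat.coprime_two_left.mp (Nat.coprime_ordCompl Nat.prime_two ht0)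
  have hcop : Nat.Coprime (ordCompl[2] t) (2 ^ n) := (Nat.coprime_two_right.mpr hodd).pow_right n
  have hudvd : ordCompl[2] t ∣ M := hcop.dvd_of_dvd_mul_left ((Nat.ordCompl_dvd t 2).trans ht)
  have hj : t.factorization 2 ≤ n := by
    have h2 : 2 ^ t.factorization 2 ∣ 2 ^ n * M := (Nat.ordProj_dvd t 2).trans ht
    have hcop' : Nat.Coprime (2 ^ t.factorization 2) M := (Nat.coprime_two_left.mpr hM).pow_left _
    exact (Nat.pow_dvd_pow_iff_le_right (by norm_num)).mp (hcop'.dvd_of_dvd_mul_right h2)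
  exact ⟨hdec, hodd, hudvd, hj⟩

/-- The complementary divisor `(2ⁿ·M)/t` of `t ∣ 2ⁿ·M` (`M` odd) in `2`-adic × odd form. -/
theorem two_pow_mul_div {n M t : ℕ} (hM : Odd M) (ht : t ∣ 2 ^ n * M) :
    2 ^ n * M / t = 2 ^ (n - t.factorization 2) * (M / ordCompl[2] t) := by
  obtain ⟨hdec, hodd, hu, hj⟩ := divisor_two_adic hM ht
  have hupos : 0 < ordCompl[2] t := hodd.pos
  have ht0 : 0 < t := by rw [hdec]; positivity
  obtain ⟨v, hv⟩ := hu
  have hv' : M / ordCompl[2] t = v := by rw [hv, Nat.mul_div_cancel_left v hupos]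
  rw [hv']
  apply Nat.div_eq_of_eq_mul_left ht0
  obtain ⟨k, hk⟩ := Nat.exists_eq_add_of_le hj
  calc 2 ^ n * M = 2 ^ (t.factorization 2 + k) * (ordCompl[2] t * v) := by rw [hk, hv]
    _ = 2 ^ k * v * (2 ^ t.factorization 2 * ordCompl[2] t) := by rw [pow_add]; ring
    _ = 2 ^ (n - t.factorization 2) * v * t := by rw [← hdec, hk, Nat.add_sub_cancel_left]

/-- `gcd(t, 2^i·M)` for `t ∣ 2ⁿ·M` (`M` odd) in `2`-adic × odd form. -/
theorem gcd_two_pow_mul {n M t : ℕ} (hM : Odd M) (ht : t ∣ 2 ^ n * M) (i : ℕ) :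
    Nat.gcd t (2 ^ i * M) = 2 ^ min (t.factorization 2) i * ordCompl[2] t := by
  obtain ⟨hdec, hodd, hu, hj⟩ := divisor_two_adic hM ht
  have hcop1 : Nat.Coprime (2 ^ i) M := (Nat.coprime_two_left.mpr hM).pow_left _
  have hcop2 : Nat.Coprime (ordCompl[2] t) (2 ^ i) := (Nat.coprime_two_right.mpr hodd).pow_right _
  have hcop3 : Nat.Coprime (2 ^ t.factorization 2) M := (Nat.coprime_two_left.mpr hM).pow_left _
  conv_lhs => rw [hdec]
  rw [Nat.Coprime.gcd_mul _ hcop1, Nat.Coprime.gcd_mul_right_cancel _ hcop2, two_pow_gcd_two_pow,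
    Nat.Coprime.gcd_mul_left_cancel _ hcop3, Nat.gcd_eq_left hu]

/-- The summand of `cuspOrder24` at the cusp of denominator `c = 2^i·M`. -/
theorem gcd_sq_mul_div_eq {n M t : ℕ} (hM : Odd M) (ht : t ∣ 2 ^ n * M) (i : ℕ) :
    ((Int.gcd (t : ℤ) ((2 ^ i * M : ℕ) : ℤ) : ℤ)) ^ 2 * ((2 ^ n * M / t : ℕ) : ℤ)
      = (M : ℤ) * (ordCompl[2] t : ℤ) * 2 ^ (2 * min i (t.factorization 2) + (n - t.factorization 2)) := by
  rw [Int.gcd_natCast_natCast, gcd_two_pow_mul hM ht, two_pow_mul_div hM ht]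
  obtain ⟨hdec, hodd, hu, hj⟩ := divisor_two_adic hM ht
  have hupos : 0 < ordCompl[2] t := hodd.pos
  obtain ⟨v, hv⟩ := hu
  have hv' : M / ordCompl[2] t = v := by rw [hv, Nat.mul_div_cancel_left v hupos]
  rw [hv', hv, min_comm]
  push_cast
  ring

/-- `cuspOrder24 (2ⁿM) (2r) (2^i·M) = 2M · Σ_t r_t u_t 2^{2 min(i,j_t) + n − j_t}`. -/
theorem cuspOrder24_two_pow_mul {n M : ℕ} (hM : Odd M) (r : ℕ → ℤ) (i : ℕ) :
    cuspOrder24 (2 ^ n * M) (fun t => 2 * r t) ((2 ^ i * M : ℕ) : ℤ)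
      = 2 * (M : ℤ) * ∑ t ∈ (2 ^ n * M).divisors,
          r t * (ordCompl[2] t : ℤ) * 2 ^ (2 * min i (t.factorization 2) + (n - t.factorization 2)) := by
  unfold cuspOrder24
  rw [Finset.mul_sum]
  refine Finset.sum_congr rfl fun t ht => ?_
  have h := gcd_sq_mul_div_eq hM (Nat.dvd_of_mem_divisors ht) i
  calc 2 * r t * ((Int.gcd (t : ℤ) ((2 ^ i * M : ℕ) : ℤ) : ℤ)) ^ 2 * ((2 ^ n * M / t : ℕ) : ℤ)
      = 2 * r t * (((Int.gcd (t : ℤ) ((2 ^ i * M : ℕ) : ℤ) : ℤ)) ^ 2 * ((2 ^ n * M / t : ℕ) : ℤ)) := by ring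
    _ = 2 * r t * ((M : ℤ) * (ordCompl[2] t : ℤ) * 2 ^ (2 * min i (t.factorization 2) + (n - t.factorization 2))) := by
      rw [h]
    _ = _ := by ring

/-- The even-cusp-order condition at `c = 2^i·M` (`i ≤ n`), with the factor `2M` cancelled. -/
theorem cusp_condition_two_pow {n M : ℕ} (hM : Odd M) (r : ℕ → ℤ)
    (hev : HasEvenCuspOrders (2 ^ n * M) (fun t => 2 * r t)) {i : ℕ} (hi : i ≤ n) :
    (24 * 2 ^ (i + min i (n - i)) : ℤ) ∣ ∑ t ∈ (2 ^ n * M).divisors,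
        r t * (ordCompl[2] t : ℤ) * 2 ^ (2 * min i (t.factorization 2) + (n - t.factorization 2)) := by
  have hMpos : 0 < M := hM.pos
  have hc : 2 ^ i * M ∣ 2 ^ n * M := Nat.mul_dvd_mul_right (pow_dvd_pow 2 hi) M
  have hmem : 2 ^ i * M ∈ (2 ^ n * M).divisors := Nat.mem_divisors.mpr ⟨hc, by positivity⟩
  have h := hev _ hmem
  rw [cuspOrder24_two_pow_mul hM r i] at h
  have hNc : 2 ^ n * M / (2 ^ i * M) = 2 ^ (n - i) := by
    apply Nat.div_eq_of_eq_mul_left (by positivity)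
    rw [show 2 ^ (n - i) * (2 ^ i * M) = 2 ^ ((n - i) + i) * M by rw [pow_add]; ring, Nat.sub_add_cancel hi]
  have hg : Nat.gcd (2 ^ i * M) (2 ^ (n - i)) = 2 ^ (min i (n - i)) := by
    rw [Nat.Coprime.gcd_mul_right_cancel _ ((Nat.coprime_two_right.mpr hM).pow_right _)]
    exact two_pow_gcd_two_pow _ _
  rw [hNc, hg] at h
  push_cast at h
  have h' : (2 * (M : ℤ)) * (24 * 2 ^ (i + min i (n - i))) ∣ (2 * (M : ℤ)) * ∑ t ∈ (2 ^ n * M).divisors,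
      r t * (ordCompl[2] t : ℤ) * 2 ^ (2 * min i (t.factorization 2) + (n - t.factorization 2)) := by
    have e : (48 * (2 ^ i * (M : ℤ)) * 2 ^ (min i (n - i))) = (2 * (M : ℤ)) * (24 * 2 ^ (i + min i (n - i))) := by
      ring
    rwa [e] at h
  exact (mul_dvd_mul_iff_left (by positivity)).mp h'

end Summit.BirchSwinnertonDyer.Rank1Residual.ManinAdditive.SigmaEta
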